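import Mathlib
import HarnessLib
import Summits.ValiantsHypothesis.ValiantsHypothesis.Theses.MonotoneRestoration
import Literature.Computability.AlgebraicComplexity.PatternExpressions
import Literature.Computability.AlgebraicComplexity.ValiantClasses
import Literature.Combinatorics.SimpleGraph.TreeDecomposition
import Summits.ValiantsHypothesis.ValiantsHypothesis.Theorems.MonotoneRestorationOrbitRestorationLinearVolumeQPHomogeneous
import Summits.ValiantsHypothesis.ValiantsHypothesis.Theorems.MonotoneRestorationOrbitRestorationLinearVolumeQPNarrow

/-!
# Route MonotoneRestoration — aside `OrbitRestorationLinearVolumeQP` (stmt-ValiantsHypothesis-18294), line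
# `birth`: HOMOGENEOUS / PURE NORMAL FORM OF THE REGISTERED OPEN STUB `stub_lvNarrowSpan`

Helper file (`--supports stmt-ValiantsHypothesis-18294`), def-free.  The one open stub of the registered
skeleton is the LINEAR-VOLUME NARROW-SPAN statement `LvNarrowSpan` (spelled out below exactly as the
hypothesis of `OrbitRestorationLinearVolumeQPNarrow.orbitRestorationLinearVolumeQP_of_lvNarrowSpan`): every
`VP` family that is, level by level, a combination of `≤ (n+2)^c` homomorphism polynomials of bipartite
patterns with `≤ c (n+1)` vertices lies, for one constant `c'` and every `n`, in the `ℂ`-span of the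
homomorphism polynomials of patterns of treewidth `≤ (log₂ n + c')^c'`.  Companion of
`Theorems/…OrbitRestorationLinearVolumeQPHomogeneous.lean` (the same normal form for R1 itself):

* `narrowSpan_mono` — the narrow span grows with the treewidth budget;
  `homogeneousComponent_mem_narrowSpan` — NARROW SPANS ARE GRADED: closed under every homogeneous component
  (`hom_{F,n}` is homogeneous of degree `|E(F)|`); `lvExpansion_mem_span_treewidth` — a linear-volume
  expansion lies in the span with treewidth budget `c (n+1)` (`treewidth ≤ |V| − 1`);
* ★ `lvNarrowSpan_iff_homogeneous` — **`LvNarrowSpan` ⟺ `LvNarrowSpan` on HOMOGENEOUS families**, by the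
  hardest-component selection on `ω(n,d)` = least treewidth budget `w` with `f_n^{(d)}` in the span of the
  `hom_{F,n}`, `tw F ≤ w` (components of a `VP` family of the class are `VP` families of the class,
  `OrbitRestorationLinearVolumeQPHomogeneous.isVPFamily_homogeneousComponent` /
  `homogeneousComponent_lvExpansion`; spans are closed under sums);
  `lvNarrowSpan_iff_pure` — ⟺ on PURE presentations (every pattern with a non-zero coefficient has exactly
  `deg f_n` edges);
* `orbitRestorationLinearVolumeQP_of_lvNarrowSpan_pure` — hence R1 follows from the pure homogeneous case of
  the stub alone (composition with `orbitRestorationLinearVolumeQP_of_lvNarrowSpan`).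

Honest label: a normal form of an OPEN stub (Dwivedi–Pago–Seppelt Outlook Q3 at quasi-polynomial scale;
VH-strength by `…LvNarrowSpanVH`); the stub, R1, the crux `OrbitRestorationQP` and VP ≠ VNP are NOT moved.
References: Dwivedi–Pago–Seppelt 2026 eq. (1), Outlook Q3; Dawar–Pago–Seppelt 2025 §5.
-/

noncomputable section

-- `Summit.ValiantsHypothesis.ValiantsHypothesis.…` is the tree's single-conjunct layout (Sub = Summit).
set_option linter.dupNamespace false

namespace Summit.ValiantsHypothesis.ValiantsHypothesis.Theorems.OrbitRestorationLinearVolumeQPNarrowSpanHomogeneous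

open Literature.Computability.AlgebraicComplexity MvPolynomial
open Summit.ValiantsHypothesis.ValiantsHypothesis.Theorems

/-! ### Narrow spans: monotone in the budget, graded, and containing the linear-volume expansions -/

/-- The span of the homomorphism polynomials of patterns of treewidth `≤ w` grows with `w`. [folklore] -/
theorem narrowSpan_mono {n w w' : ℕ} (h : w ≤ w') :
    Submodule.span ℂ {p : MvPolynomial (Fin n × Fin n) ℂ | ∃ (a b : ℕ) (E : Multiset (Fin a × Fin b)),
        Literature.Combinatorics.SimpleGraph.treewidth
            (SimpleGraph.fromRel fun u v : Fin a ⊕ Fin b =>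
              ∃ e ∈ E, u = Sum.inl e.1 ∧ v = Sum.inr e.2) ≤ w ∧ p = homPoly E n ℂ} ≤
    Submodule.span ℂ {p : MvPolynomial (Fin n × Fin n) ℂ | ∃ (a b : ℕ) (E : Multiset (Fin a × Fin b)),
        Literature.Combinatorics.SimpleGraph.treewidth
            (SimpleGraph.fromRel fun u v : Fin a ⊕ Fin b =>
              ∃ e ∈ E, u = Sum.inl e.1 ∧ v = Sum.inr e.2) ≤ w' ∧ p = homPoly E n ℂ} := by
  refine Submodule.span_mono ?_
  rintro p ⟨a, b, E, hE, rfl⟩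
  exact ⟨a, b, E, hE.trans h, rfl⟩

/-- **Narrow spans are graded**: the degree-`d` component of an element of the span of the `hom_{F,n}`,
`tw F ≤ w`, lies in the same span (each generator is homogeneous of degree `|E(F)|`,
`HomPolyBasics.isHomogeneous_homPoly`). [cite: DwivediPagoSeppelt2026, eq. (1)] -/
theorem homogeneousComponent_mem_narrowSpan {n w : ℕ} (d : ℕ) {p : MvPolynomial (Fin n × Fin n) ℂ}
    (hp : p ∈ Submodule.span ℂ {p : MvPolynomial (Fin n × Fin n) ℂ |
        ∃ (a b : ℕ) (E : Multiset (Fin a × Fin b)),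
          Literature.Combinatorics.SimpleGraph.treewidth
              (SimpleGraph.fromRel fun u v : Fin a ⊕ Fin b =>
                ∃ e ∈ E, u = Sum.inl e.1 ∧ v = Sum.inr e.2) ≤ w ∧ p = homPoly E n ℂ}) :
    homogeneousComponent d p ∈ Submodule.span ℂ {p : MvPolynomial (Fin n × Fin n) ℂ |
        ∃ (a b : ℕ) (E : Multiset (Fin a × Fin b)),
          Literature.Combinatorics.SimpleGraph.treewidth
              (SimpleGraph.fromRel fun u v : Fin a ⊕ Fin b =>
                ∃ e ∈ E, u = Sum.inl e.1 ∧ v = Sum.inr e.2) ≤ w ∧ p = homPoly E n ℂ} := by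
  refine Submodule.span_induction (p := fun q _ => homogeneousComponent d q ∈ _) ?_ ?_ ?_ ?_ hp
  · rintro q ⟨a, b, E, hE, rfl⟩
    rw [homogeneousComponent_of_mem
      ((mem_homogeneousSubmodule _ _).2 (HomPolyBasics.isHomogeneous_homPoly (K := ℂ) E n))]
    split_ifs
    · exact Submodule.subset_span ⟨a, b, E, hE, rfl⟩
    · exact Submodule.zero_mem _
  · rw [map_zero]
    exact Submodule.zero_mem _
  · intro q₁ q₂ _ _ h₁ h₂
    rw [map_add]
    exact Submodule.add_mem _ h₁ h₂
  · intro c q _ h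
    rw [map_smul]
    exact Submodule.smul_mem _ c h

/-- **A linear-volume expansion lies in the span with treewidth budget `w`** as soon as every pattern has
`≤ w + 1` vertices (`treewidth ≤ |V| − 1`, the trivial decomposition). [folklore] -/
theorem lvExpansion_mem_span_treewidth {n m w : ℕ} (a b : Fin m → ℕ)
    (E : (i : Fin m) → Multiset (Fin (a i) × Fin (b i))) (α : Fin m → ℂ)
    (hab : ∀ i, a i + b i ≤ w + 1) :
    (∑ i : Fin m, C (α i) * homPoly (E i) n ℂ) ∈ Submodule.span ℂ {p : MvPolynomial (Fin n × Fin n) ℂ |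
        ∃ (a b : ℕ) (E : Multiset (Fin a × Fin b)),
          Literature.Combinatorics.SimpleGraph.treewidth
              (SimpleGraph.fromRel fun u v : Fin a ⊕ Fin b =>
                ∃ e ∈ E, u = Sum.inl e.1 ∧ v = Sum.inr e.2) ≤ w ∧ p = homPoly E n ℂ} := by
  refine Submodule.sum_mem _ fun i _ => ?_
  rw [← smul_eq_C_mul]
  refine Submodule.smul_mem _ _ (Submodule.subset_span ⟨a i, b i, E i, ?_, rfl⟩)
  refine (Literature.Combinatorics.SimpleGraph.treewidth_le_card_sub_one _).trans ?_
  rw [Fintype.card_sum, Fintype.card_fin, Fintype.card_fin]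
  have := hab i
  omega

/-! ### The normal form -/

/-- ★ **HOMOGENEOUS NORMAL FORM of the registered stub `LvNarrowSpan`** (left: the stub spelled out;
right: the same on families with `f_n` homogeneous of some degree `d_n` for every `n`).  Backward direction:
hardest-component selection on the least treewidth budget, see the file header. [cite: DwivediPagoSeppelt2026, Outlook Q3] -/
theorem lvNarrowSpan_iff_homogeneous :
    (∀ f : (n : ℕ) → MvPolynomial (Fin n × Fin n) ℂ, IsVPFamily f →
      (∃ (c : ℕ) (m : ℕ → ℕ) (a b : (n : ℕ) → Fin (m n) → ℕ)
          (E : (n : ℕ) → (i : Fin (m n)) → Multiset (Fin (a n i) × Fin (b n i)))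
          (α : (n : ℕ) → Fin (m n) → ℂ),
        (∀ n, m n ≤ (n + 2) ^ c) ∧ (∀ n i, a n i + b n i ≤ c * (n + 1)) ∧
          ∀ n, f n = ∑ i : Fin (m n), C (α n i) * homPoly (E n i) n ℂ) →
      ∃ c : ℕ, ∀ n : ℕ, f n ∈ Submodule.span ℂ
        {p : MvPolynomial (Fin n × Fin n) ℂ | ∃ (a b : ℕ) (E : Multiset (Fin a × Fin b)),
          Literature.Combinatorics.SimpleGraph.treewidth
              (SimpleGraph.fromRel fun u v : Fin a ⊕ Fin b =>
                ∃ e ∈ E, u = Sum.inl e.1 ∧ v = Sum.inr e.2) ≤ (Nat.log 2 n + c) ^ c ∧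
            p = homPoly E n ℂ}) ↔
    (∀ f : (n : ℕ) → MvPolynomial (Fin n × Fin n) ℂ,
      (∃ d : ℕ → ℕ, ∀ n, (f n).IsHomogeneous (d n)) → IsVPFamily f →
      (∃ (c : ℕ) (m : ℕ → ℕ) (a b : (n : ℕ) → Fin (m n) → ℕ)
          (E : (n : ℕ) → (i : Fin (m n)) → Multiset (Fin (a n i) × Fin (b n i)))
          (α : (n : ℕ) → Fin (m n) → ℂ),
        (∀ n, m n ≤ (n + 2) ^ c) ∧ (∀ n i, a n i + b n i ≤ c * (n + 1)) ∧
          ∀ n, f n = ∑ i : Fin (m n), C (α n i) * homPoly (E n i) n ℂ) →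
      ∃ c : ℕ, ∀ n : ℕ, f n ∈ Submodule.span ℂ
        {p : MvPolynomial (Fin n × Fin n) ℂ | ∃ (a b : ℕ) (E : Multiset (Fin a × Fin b)),
          Literature.Combinatorics.SimpleGraph.treewidth
              (SimpleGraph.fromRel fun u v : Fin a ⊕ Fin b =>
                ∃ e ∈ E, u = Sum.inl e.1 ∧ v = Sum.inr e.2) ≤ (Nat.log 2 n + c) ^ c ∧
            p = homPoly E n ℂ}) := by
  constructor
  · exact fun H f _ hVP hLV => H f hVP hLV
  intro H f hVP hLV
  classical
  obtain ⟨c, m, a, b, E, α, hm, hab, hf⟩ := hLV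
  -- the linear-volume expansion of the components
  have hcompLV : ∀ n d, homogeneousComponent d (f n) =
      ∑ i : Fin (m n), C (if Multiset.card (E n i) = d then α n i else 0) * homPoly (E n i) n ℂ := by
    intro n d
    rw [hf n, OrbitRestorationLinearVolumeQPHomogeneous.homogeneousComponent_lvExpansion]
  -- every component lies in the span with SOME treewidth budget
  have hex : ∀ n d : ℕ, ∃ w : ℕ, homogeneousComponent d (f n) ∈ Submodule.span ℂ
      {p : MvPolynomial (Fin n × Fin n) ℂ | ∃ (a b : ℕ) (E : Multiset (Fin a × Fin b)),
        Literature.Combinatorics.SimpleGraph.treewidth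
            (SimpleGraph.fromRel fun u v : Fin a ⊕ Fin b =>
              ∃ e ∈ E, u = Sum.inl e.1 ∧ v = Sum.inr e.2) ≤ w ∧ p = homPoly E n ℂ} := by
    intro n d
    refine ⟨c * (n + 1), ?_⟩
    rw [hcompLV]
    exact lvExpansion_mem_span_treewidth (a n) (b n) (E n) _ fun i => by have := hab n i; omega
  -- `ω n d`: the least such budget
  let ω : ℕ → ℕ → ℕ := fun n d => Nat.find (hex n d)
  have hω_spec : ∀ n d : ℕ, homogeneousComponent d (f n) ∈ Submodule.span ℂ
      {p : MvPolynomial (Fin n × Fin n) ℂ | ∃ (a b : ℕ) (E : Multiset (Fin a × Fin b)),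
        Literature.Combinatorics.SimpleGraph.treewidth
            (SimpleGraph.fromRel fun u v : Fin a ⊕ Fin b =>
              ∃ e ∈ E, u = Sum.inl e.1 ∧ v = Sum.inr e.2) ≤ ω n d ∧ p = homPoly E n ℂ} :=
    fun n d => Nat.find_spec (hex n d)
  have hω_min : ∀ (n d w : ℕ), homogeneousComponent d (f n) ∈ Submodule.span ℂ
      {p : MvPolynomial (Fin n × Fin n) ℂ | ∃ (a b : ℕ) (E : Multiset (Fin a × Fin b)),
        Literature.Combinatorics.SimpleGraph.treewidth
            (SimpleGraph.fromRel fun u v : Fin a ⊕ Fin b =>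
              ∃ e ∈ E, u = Sum.inl e.1 ∧ v = Sum.inr e.2) ≤ w ∧ p = homPoly E n ℂ} → ω n d ≤ w :=
    fun n d w hw => Nat.find_min' (hex n d) hw
  -- the hardest component per level
  have hmax : ∀ n : ℕ, ∃ d : ℕ, ∀ d' : ℕ, d' ≤ (f n).totalDegree → ω n d' ≤ ω n d := by
    intro n
    obtain ⟨d, -, hd⟩ := Finset.exists_max_image (Finset.range ((f n).totalDegree + 1)) (ω n)
      ⟨0, Finset.mem_range.2 (Nat.succ_pos _)⟩
    exact ⟨d, fun d' hd' => hd d' (Finset.mem_range.2 (Nat.lt_succ_of_le hd'))⟩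
  choose dstar hdstar using hmax
  obtain ⟨c₁, hc₁⟩ := H (fun n => homogeneousComponent (dstar n) (f n))
    ⟨dstar, fun n => homogeneousComponent_isHomogeneous (dstar n) (f n)⟩
    (OrbitRestorationLinearVolumeQPHomogeneous.isVPFamily_homogeneousComponent f hVP dstar)
    ⟨c, m, a, b, E, fun n i => if Multiset.card (E n i) = dstar n then α n i else 0, hm, hab,
      fun n => hcompLV n (dstar n)⟩
  refine ⟨c₁, fun n => ?_⟩
  have hK : ∀ d : ℕ, d ≤ (f n).totalDegree → ω n d ≤ (Nat.log 2 n + c₁) ^ c₁ :=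
    fun d hd => (hdstar n d hd).trans (hω_min n (dstar n) _ (hc₁ n))
  rw [← sum_homogeneousComponent (f n)]
  exact Submodule.sum_mem _ fun d hd =>
    narrowSpan_mono (hK d (Nat.le_of_lt_succ (Finset.mem_range.1 hd))) (hω_spec n d)

/-- ★ **PURE NORMAL FORM of the registered stub**: `LvNarrowSpan` holds if and only if it holds for the
`VP` families presented, level by level, as linear-volume combinations in which `f_n` is homogeneous of
degree `d_n` and every pattern with a non-zero coefficient has exactly `d_n` edges. [cite: DwivediPagoSeppelt2026, Outlook Q3] -/
theorem lvNarrowSpan_iff_pure :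
    (∀ f : (n : ℕ) → MvPolynomial (Fin n × Fin n) ℂ, IsVPFamily f →
      (∃ (c : ℕ) (m : ℕ → ℕ) (a b : (n : ℕ) → Fin (m n) → ℕ)
          (E : (n : ℕ) → (i : Fin (m n)) → Multiset (Fin (a n i) × Fin (b n i)))
          (α : (n : ℕ) → Fin (m n) → ℂ),
        (∀ n, m n ≤ (n + 2) ^ c) ∧ (∀ n i, a n i + b n i ≤ c * (n + 1)) ∧
          ∀ n, f n = ∑ i : Fin (m n), C (α n i) * homPoly (E n i) n ℂ) →
      ∃ c : ℕ, ∀ n : ℕ, f n ∈ Submodule.span ℂ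
        {p : MvPolynomial (Fin n × Fin n) ℂ | ∃ (a b : ℕ) (E : Multiset (Fin a × Fin b)),
          Literature.Combinatorics.SimpleGraph.treewidth
              (SimpleGraph.fromRel fun u v : Fin a ⊕ Fin b =>
                ∃ e ∈ E, u = Sum.inl e.1 ∧ v = Sum.inr e.2) ≤ (Nat.log 2 n + c) ^ c ∧
            p = homPoly E n ℂ}) ↔
    (∀ f : (n : ℕ) → MvPolynomial (Fin n × Fin n) ℂ, IsVPFamily f →
      (∃ (d : ℕ → ℕ) (c : ℕ) (m : ℕ → ℕ) (a b : (n : ℕ) → Fin (m n) → ℕ)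
          (E : (n : ℕ) → (i : Fin (m n)) → Multiset (Fin (a n i) × Fin (b n i)))
          (α : (n : ℕ) → Fin (m n) → ℂ),
        (∀ n, (f n).IsHomogeneous (d n)) ∧
        (∀ n, m n ≤ (n + 2) ^ c) ∧ (∀ n i, a n i + b n i ≤ c * (n + 1)) ∧
        (∀ n i, Multiset.card (E n i) ≠ d n → α n i = 0) ∧
          ∀ n, f n = ∑ i : Fin (m n), C (α n i) * homPoly (E n i) n ℂ) →
      ∃ c : ℕ, ∀ n : ℕ, f n ∈ Submodule.span ℂ
        {p : MvPolynomial (Fin n × Fin n) ℂ | ∃ (a b : ℕ) (E : Multiset (Fin a × Fin b)),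
          Literature.Combinatorics.SimpleGraph.treewidth
              (SimpleGraph.fromRel fun u v : Fin a ⊕ Fin b =>
                ∃ e ∈ E, u = Sum.inl e.1 ∧ v = Sum.inr e.2) ≤ (Nat.log 2 n + c) ^ c ∧
            p = homPoly E n ℂ}) := by
  rw [lvNarrowSpan_iff_homogeneous]
  constructor
  · intro H f hVP hpure
    obtain ⟨d, c, m, a, b, E, α, hhom, hm, hab, -, hf⟩ := hpure
    exact H f ⟨d, hhom⟩ hVP ⟨c, m, a, b, E, α, hm, hab, hf⟩
  · intro H f hhom hVP hLV
    obtain ⟨d, hd⟩ := hhom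
    obtain ⟨c, m, a, b, E, α, hm, hab, hf⟩ := hLV
    refine H f hVP ⟨d, c, m, a, b, E, fun n i => if Multiset.card (E n i) = d n then α n i else 0,
      hd, hm, hab, fun n i hi => if_neg hi, fun n => ?_⟩
    rw [← OrbitRestorationLinearVolumeQPHomogeneous.homogeneousComponent_lvExpansion, ← hf n,
      homogeneousComponent_of_mem ((mem_homogeneousSubmodule _ _).2 (hd n)), if_pos rfl]

/-- **R1 from the pure homogeneous case of the registered stub alone.** [cite: DwivediPagoSeppelt2026, Outlook Q3] -/
theorem orbitRestorationLinearVolumeQP_of_lvNarrowSpan_pure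
    (H : ∀ f : (n : ℕ) → MvPolynomial (Fin n × Fin n) ℂ, IsVPFamily f →
      (∃ (d : ℕ → ℕ) (c : ℕ) (m : ℕ → ℕ) (a b : (n : ℕ) → Fin (m n) → ℕ)
          (E : (n : ℕ) → (i : Fin (m n)) → Multiset (Fin (a n i) × Fin (b n i)))
          (α : (n : ℕ) → Fin (m n) → ℂ),
        (∀ n, (f n).IsHomogeneous (d n)) ∧
        (∀ n, m n ≤ (n + 2) ^ c) ∧ (∀ n i, a n i + b n i ≤ c * (n + 1)) ∧
        (∀ n i, Multiset.card (E n i) ≠ d n → α n i = 0) ∧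
          ∀ n, f n = ∑ i : Fin (m n), C (α n i) * homPoly (E n i) n ℂ) →
      ∃ c : ℕ, ∀ n : ℕ, f n ∈ Submodule.span ℂ
        {p : MvPolynomial (Fin n × Fin n) ℂ | ∃ (a b : ℕ) (E : Multiset (Fin a × Fin b)),
          Literature.Combinatorics.SimpleGraph.treewidth
              (SimpleGraph.fromRel fun u v : Fin a ⊕ Fin b =>
                ∃ e ∈ E, u = Sum.inl e.1 ∧ v = Sum.inr e.2) ≤ (Nat.log 2 n + c) ^ c ∧
            p = homPoly E n ℂ}) :
    Summit.ValiantsHypothesis.ValiantsHypothesis.Theses.MonotoneRestoration.OrbitRestorationLinearVolumeQP :=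
  OrbitRestorationLinearVolumeQPNarrow.orbitRestorationLinearVolumeQP_of_lvNarrowSpan
    (lvNarrowSpan_iff_pure.2 H)

end Summit.ValiantsHypothesis.ValiantsHypothesis.Theorems.OrbitRestorationLinearVolumeQPNarrowSpanHomogeneous

end
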